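import Literature.MathematicalPhysics.QuantumFieldTheory.Balaban1983to89.Beta.ResolventReflection
import Literature.MathematicalPhysics.QuantumFieldTheory.Balaban1983to89.Beta.AxialProjector
import Literature.MathematicalPhysics.QuantumFieldTheory.Balaban1983to89.Beta.AveragingContoursRooted

/-!
# Rooted block combs: the root parameter `ρ`, the centred root, and reflection transport

HONEST FRAMING (cell rule, verbatim): discharging `BetaPertH` makes Bałaban's UV stability UNCONDITIONAL — a real
constructive-QFT result; it is NOT the continuum limit and NOT the Clay problem.  Nothing in this file is `BetaPertH`, an
(α)/(β) leaf of the β-wall, or summit progress.  Every declaration is [folklore] lattice combinatorics / linear algebra,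
kernel-checked; nothing is cited, no `Prop` is minted, no hypothesis of any wall statement is discharged here.

## What this leaf is for

The typed contour system of the β sub-cell (`AveragingContours.gammaC / loopC / linAvg / treeGauge`,
`AxialProjector.axProj`, and an2's dressing built on them) roots every block comb at the BASE CORNER `L•y` of the
block `L•y + {0,…,L−1}^d`.  The block-compatible axis reflections of the fine lattice are `sref α : x_α ↦ −1 − x_α`
(`ResolventReflection.sref`, `sref_block`): they carry the block of `y` onto the block of `bref α α y` but carry the base
corner to the α-TOP corner, so NO base-rooted construction is mapped to itself (`sref_base_ne_base`), and indeed the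
base-rooted linear averaging is not reflection-covariant (explicit `d = 2`, `L = 2` instance, kernel-checked in the
seat records `CornerRootInstance`; not re-proved here).  In print the blocks are CENTRED: [Balaban1987RG1] = CMP 109,
p.251 «L is an odd, positive integer > 11 … Each lattice determines a lattice of centers of these cubes», p.252 (0.3)
«B^k(y) = Δ(y) ∩ T…, Δ(y) is a continuous space cube with a center at y», contours `G(y,x)` «with the initial point at y»
and `|n_μ| ≤ (L−1)/2` (orientation only — these sentences fix a convention, they are not used as hypotheses).

ONE DEFINITION OF THE ROOTED OBJECTS: the root-parametric contour system — `gammaCAt ρ`, `loopCAt ρ`, `linAvgAt ρ`,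
`LamAt ρ`, `AxialGaugeAt ρ`, `treeGaugeAt ρ`, the centre offset `ctrOff d L = ((L−1)/2, …)`, `ctr d L = toSite (ctrOff d L)`
and the `ρ = 0` bridges to the landed objects — is an1's leaf `…Beta.AveragingContoursRooted` (imported BY NAME, nothing
re-defined here); this leaf adds the ONE rooted object an1's leaf does not carry (the rooted axial PROJECTOR `axProjAt ρ`,
bridged to an2's `axProj` at `ρ = 0`) and the REFLECTION TRANSPORT of all of them at the centre (coordination note: the
β-lead's decision to re-root the road's family at the block centre, journal RULING (R32), is a programme decision and is
NOT cited as a fact anywhere in this file):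

* §1 **(F0⁺) `sref_root_ctr`**: for `Odd L`, `sref α (L•y + ctr d L) = L•(sref α y) + ctr d L` for EVERY axis `α`
  (`two_mul_ctr_add_one : 2·(ctr d L) i + 1 = L`, the integer form of an1's `two_mul_half_add_one`);
  **(F0⁻) `two_mul_add_one_eq_of_sref_root`**: conversely an in-block root offset whose rooted lattice is `sref α`-stable
  has `2ρ_α + 1 = L` (so `L` is odd and `ρ_α` is the centre coordinate); `sref_base_ne_base` (`2 ≤ L`); `blk_sref`.
* §2 reflection transport of the contour PRIMITIVES of `AveragingContours` under the pull-back `R1 α` of 1-forms: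
  `corner_sref`, `segUp_R1_of_ne/_self`, `segDown_R1_of_ne/_self`, `seg_R1`, **`axial_R1`**
  (`axial (R1 α A) y x = axial A (sref α y) (sref α x)` — the fixed-axis-order comb path is transported to the comb path
  of the reflected endpoints, letter by letter), `segDown_eq_rev_segUp`.
* §3 the rooted axial projector `axProjAt ρ L A = A − grad (treeGaugeAt ρ A L)` (over an1's rooted tree gauge),
  `axProjAt_zero : axProjAt 0 L = axProj L` (an2's projector IS the base-rooted instance), `axProjAt_apply`;
  for in-block root offsets `toSite r`, `r ∈ box d L`: `treeGaugeAt_block`, `treeGaugeAt_root`, `axialGaugeAt_axProjAt`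
  (the range of `Π^ρ` is the rooted axial gauge — an1's `axialGaugeAt_treeGaugeAt` by name),
  `treeGaugeAt_eq_zero_of_axialGaugeAt`, **`axProjAt_idem`**, `axProjAt_eq_self_of_axialGaugeAt`; `ctr_eq_toSite` (with
  an1's `ctrOff_mem_box`) makes every one of them available at the centre `ctr d L`.
* §4 THE CENTRED OBJECTS ARE REFLECTION-COVARIANT (`Odd L`, every axis `α`, real coefficients):
  `straightSum_R1`, `LamAt_R1`, **`linAvgAt_R1 : linAvgAt (ctr d L) (R1 α A) L = R1 α (linAvgAt (ctr d L) A L)`**,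
  `treeGaugeAt_R1 : treeGaugeAt (ctr d L) (R1 α A) L = R0 α (treeGaugeAt (ctr d L) A L)`,
  **`axProjAt_R1 : axProjAt (ctr d L) L (R1 α A) = R1 α (axProjAt (ctr d L) L A)`**, `axialGaugeAt_R1`, with `grad_R0`.
* §5 the same at the level of CONTOUR LISTS (what a consumer re-deriving counts / kernels from the lists needs):
  `gammaCAt_R1_of_ne` (transverse axis: the centred contour of `(y, b)` for `R1 α A` is the centred contour of
  `(sref α y, bflip α L b)` for `A`), `gammaCAt_R1_self` (longitudinal axis: it is the REVERSED contour of
  `(bref α α y, bflip α L b)`), `loopCAt_R1_of_ne`, `loopCAt_R1_self` (reversed and rotated by `L`), and the letter sums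
  `gammaCAt_R1_sum`, `loopCAt_R1_sum` (sign `reflSign α μ`).

## What is NOT here (and why)

* Nothing about the undressed or dressed STEP JETS: the ρ-threading of an1's node-5 counts/kernels (`gammaC`-based
  `vhS`, `hessFF`, the (P4) tables) and of an2's `dressAt` / `JsBal0Of` / `JsBalOf` is their lineages' (one-writer rule);
  this leaf only provides the primitives and the transport lemmas they instantiate.  In particular the jet-level
  reflection sockets (Sr)/(Wr) of `ResolventReflection.axisReflectionCovariant_flipK_TbalOf` are NOT discharged here for
  any family.
* No identity `·_ρ = shift ∘ ·_0`: the rooted contour system is NOT the fine translate of the base-rooted one (the BLOCK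
  `L•y + box` does not move with the root; translating by `ρ` moves the targets out of the block), which is why the root
  is an explicit parameter of an1's twins rather than a translation lemma.  What does hold is an1's
  `linAvgAt_eq_straight_sub_grad` / `linAvgAt_eq_linAvg_add`: the straight part of `linAvgAt ρ` is root-independent, only
  the coarse-gradient term `LamAt ρ` sees the root (re-rooting is a coarse exact form at linear order).
* Axis PERMUTATION covariance (μ ↔ ν) of the fixed-axis-order comb is not treated (not block-automatic; not requested).
* Even `L`: (F0⁻) shows no in-block root is reflection-stable, so no covariance statement is claimed for even `L`.

## Dead ends recorded

reflections `x_α ↦ −x_α` / negation ∘ translation (not block-compatible); base-rooted covariance under any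
block-compatible reflection (false, `CornerRootInstance`); `·_ρ = shift ∘ ·_0` (false at the level of `linAvg`);
unfolding `AveragingContours.segUp` (a mapped coerced `List.range`) — use the cons recursion `segUp_succ'` instead.

VERSION v1 (2026-08-19, b2b-balaban-beta-an5-g17): new leaf; imports `…Beta.ResolventReflection` (v1.1),
`…Beta.AxialProjector` and an1's `…Beta.AveragingContoursRooted` (v1) BY NAME; no existing file touched, no rooted
contour object re-defined.
-/

namespace Literature.MathematicalPhysics.QuantumFieldTheory.Balaban1983to89.Beta.RootedComb

open Finset
open scoped BigOperators
open AffineAveraging (Form0 Form1 unitVec unitVec_apply box toSite contourSum dz)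
open AveragingContours (grad shift segUp segDown seg rev corner axialAux axial gammaC loopC linAvg straightSum Lam blk
  treeGauge AxialGauge rev_sum grad_eq_dz straightSum_eq_contourSum axial_self blk_block)
open AxialProjector (axProj)
open AveragingContoursRooted (gammaCAt loopCAt linAvgAt LamAt AxialGaugeAt treeGaugeAt ctrOff ctr ctr_apply ctrOff_mem_box
  gammaCAt_zero loopCAt_zero linAvgAt_zero LamAt_zero treeGaugeAt_zero axialGaugeAt_zero_iff linAvgAt_eq_straight_sub_grad
  axialGaugeAt_treeGaugeAt two_mul_half_add_one)
open PolarizationSign (axisReflect axisReflect_apply reflSign)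
open ResolventReflection (sref sref_apply sref_add sref_sub bref bref_apply bref_of_ne bref_self bref_add R0 R0_apply R1
  R1_apply R1_add bflip bflip_mem mem_box sref_block toSite_bflip toSite_apply sum_box_bflip reflSign_self reflSign_of_ne
  axisReflect_zsmul axisReflect_unitVec_of_ne axisReflect_unitVec_self neg_one_sub_ediv contourSum_R1 dz_R0)

variable {d : ℕ}

/-! ## §1 The centre root and (F0) -/

section Roots

/-- [folklore] For odd `L` the centre coordinate `c = (L−1)/2` satisfies `2c + 1 = L`. -/
theorem two_mul_ctr_add_one {L : ℕ} (hL : Odd L) (i : Fin d) : 2 * ctr d L i + 1 = L := by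
  obtain ⟨k, hk⟩ := hL
  subst hk
  rw [ctr_apply]
  have : (2 * k + 1 - 1) / 2 = k := by omega
  rw [this]; push_cast; ring

/-- [folklore] **(F0⁺) THE CENTRE ROOT IS REFLECTED TO THE CENTRE ROOT** (`L` odd): `sref α (L•y + ρ_c) = L•(sref α y) + ρ_c`
for EVERY axis `α`. -/
theorem sref_root_ctr {L : ℕ} (hL : Odd L) (α : Fin d) (y : Fin d → ℤ) :
    sref α ((L : ℤ) • y + ctr d L) = (L : ℤ) • sref α y + ctr d L := by
  funext i
  have hc := two_mul_ctr_add_one (d := d) hL i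
  simp only [sref_apply, Pi.add_apply, Pi.smul_apply, smul_eq_mul]
  by_cases hi : i = α
  · simp only [hi, if_true]
    have hc' := two_mul_ctr_add_one (d := d) hL α
    linear_combination (-1 : ℤ) * hc'
  · simp [hi]

/-- [folklore] **(F0⁻) ONLY THE CENTRE ROOT IS**: if the reflection of axis `α` carries the root `L•y + ρ` of an in-block offset
`ρ` (`0 ≤ ρ_α < L`) to the root `L•y′ + ρ` of some block, then `2ρ_α + 1 = L` (so `L` is odd and `ρ_α` is the centre
coordinate). -/
theorem two_mul_add_one_eq_of_sref_root {L : ℕ} {ρ : Fin d → ℤ} {α : Fin d} (h0 : 0 ≤ ρ α) (hρ : ρ α < L)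
    {y y' : Fin d → ℤ} (h : sref α ((L : ℤ) • y + ρ) = (L : ℤ) • y' + ρ) : 2 * ρ α + 1 = L := by
  have hα := congrFun h α
  simp only [sref_apply, if_true, Pi.add_apply, Pi.smul_apply, smul_eq_mul] at hα
  -- hα : -1 - (L * y α + ρ α) = L * y' α + ρ α
  have hs : (L : ℤ) * (y α + y' α) = -(2 * ρ α + 1) := by linear_combination (-1 : ℤ) * hα
  rcases le_or_gt (y α + y' α) (-2) with h1 | h1
  · nlinarith
  rcases le_or_gt 0 (y α + y' α) with h2 | h2
  · nlinarith
  have h3 : y α + y' α = -1 := by omega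
  rw [h3] at hs
  linarith

/-- [folklore] In particular the BASE root (`ρ = 0`: every typed comb of `AveragingContours`/`AxialProjector`) is reflected to
a base root by NO axis reflection once `2 ≤ L`. -/
theorem sref_base_ne_base {L : ℕ} (hL : 2 ≤ L) (α : Fin d) (y y' : Fin d → ℤ) :
    sref α ((L : ℤ) • y) ≠ (L : ℤ) • y' := by
  intro h
  have h' : sref α ((L : ℤ) • y + 0) = (L : ℤ) • y' + 0 := by simpa only [add_zero] using h
  have := two_mul_add_one_eq_of_sref_root (L := L) (ρ := (0 : Fin d → ℤ)) (α := α) (le_refl _)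
    (by simp only [Pi.zero_apply]; exact_mod_cast (by omega : 0 < L)) h'
  simp only [Pi.zero_apply, mul_zero, zero_add] at this
  omega

/-- [folklore] The reflection of the block index: `blk L (sref α x) = sref α (blk L x)` (`1 ≤ L`). -/
theorem blk_sref {L : ℕ} (hL : 1 ≤ L) (α : Fin d) (x : Fin d → ℤ) : blk L (sref α x) = sref α (blk L x) := by
  funext i
  simp only [blk, sref_apply]
  split_ifs
  · exact neg_one_sub_ediv _ (by exact_mod_cast hL)
  · rfl

end Roots

/-! ## §2 Reflection transport of the comb primitives -/

section Primitives

/-- [folklore] Corners of the reflected pair are the reflected corners (the comb's axis ORDER is reflection-invariant). -/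
theorem corner_sref (α : Fin d) (y x : Fin d → ℤ) (m : ℕ) : corner (sref α y) (sref α x) m = sref α (corner y x m) := by
  funext j
  simp only [corner, sref_apply]
  split_ifs <;> rfl

/-- [folklore] A straight segment of the pulled-back form across the axis: the same segment from the reflected point. -/
theorem segUp_R1_of_ne {α κ : Fin d} (h : κ ≠ α) (A : Form1 d ℝ) (z : Fin d → ℤ) (n : ℕ) :
    segUp (R1 α A) z κ n = segUp A (sref α z) κ n := by
  simp only [segUp, R1_apply, reflSign_of_ne h, one_mul, bref_of_ne h, sref_add, axisReflect_zsmul,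
    axisReflect_unitVec_of_ne h]

/-- [folklore] A straight segment of the pulled-back form ALONG the axis: the DOWNWARD segment from the reflected point. -/
theorem segUp_R1_self (α : Fin d) (A : Form1 d ℝ) (z : Fin d → ℤ) (n : ℕ) :
    segUp (R1 α A) z α n = segDown A (sref α z) α n := by
  simp only [segUp, segDown, R1_apply, reflSign_self, bref_self, sref_add, axisReflect_zsmul, axisReflect_unitVec_self]
  refine List.map_congr_left fun s _ => ?_
  rw [neg_one_mul, smul_neg, add_smul, one_smul]
  congr 2
  abel

/-- [folklore] A downward segment of the pulled-back form across the axis. -/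
theorem segDown_R1_of_ne {α κ : Fin d} (h : κ ≠ α) (A : Form1 d ℝ) (z : Fin d → ℤ) (n : ℕ) :
    segDown (R1 α A) z κ n = segDown A (sref α z) κ n := by
  simp only [segDown, R1_apply, reflSign_of_ne h, one_mul, bref_of_ne h, sref_sub, axisReflect_zsmul,
    axisReflect_unitVec_of_ne h]

/-- [folklore] A downward segment of the pulled-back form along the axis: the UPWARD segment from the reflected point. -/
theorem segDown_R1_self (α : Fin d) (A : Form1 d ℝ) (z : Fin d → ℤ) (n : ℕ) :
    segDown (R1 α A) z α n = segUp A (sref α z) α n := by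
  simp only [segUp, segDown, R1_apply, reflSign_self, bref_self, sref_sub, axisReflect_zsmul, axisReflect_unitVec_self]
  refine List.map_congr_left fun s _ => ?_
  rw [neg_one_mul, neg_neg, smul_neg, add_smul, one_smul]
  congr 2
  abel

/-- [folklore] The signed segment of the pulled-back form: the segment from the reflected point, length negated on the axis. -/
theorem seg_R1 (α κ : Fin d) (A : Form1 d ℝ) (z : Fin d → ℤ) (n : ℤ) :
    seg (R1 α A) z κ n = seg A (sref α z) κ (if κ = α then -n else n) := by
  by_cases h : κ = α
  · subst h
    simp only [if_true, seg]
    rcases lt_trichotomy n 0 with hn | rfl | hn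
    · rw [if_neg (not_le.2 hn), if_pos (by omega), segDown_R1_self]
    · simp [segUp]
    · rw [if_pos hn.le, if_neg (by omega), segUp_R1_self, neg_neg]
  · simp only [if_neg h, seg, segUp_R1_of_ne h, segDown_R1_of_ne h]

/-- [folklore] The comb letters of the pulled-back form = the comb letters between the reflected endpoints (every level). -/
theorem axialAux_R1 (α : Fin d) (A : Form1 d ℝ) (y x : Fin d → ℤ) (m : ℕ) :
    axialAux (R1 α A) y x m = axialAux A (sref α y) (sref α x) m := by
  induction m with
  | zero => rfl
  | succ m ih =>
    simp only [axialAux, ih, corner_sref, seg_R1]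
    congr 1
    by_cases h : m < d
    · rw [dif_pos h, dif_pos h]
      congr 1
      simp only [sref_apply, Fin.ext_iff]
      split_ifs <;> ring
    · rw [dif_neg h, dif_neg h]

/-- [folklore] **THE COMB IS TRANSPORTED:** `axial (R1 α A) y x = axial A (sref α y) (sref α x)` — the letters of the
pulled-back form along the comb path `y → x` ARE the letters of the form along the comb path `sref y → sref x` (same axis
order, the `α`-leg reversed and re-signed, which is what `R1` encodes). -/
theorem axial_R1 (α : Fin d) (A : Form1 d ℝ) (y x : Fin d → ℤ) : axial (R1 α A) y x = axial A (sref α y) (sref α x) :=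
  axialAux_R1 α A y x d

/-- [folklore] One more bond, `+κ`, at the FRONT: `segUp A w κ (n+1) = A_κ(w) :: segUp A (w + e_κ) κ n`. -/
theorem segUp_succ' {R : Type*} (A : Form1 d R) (w : Fin d → ℤ) (κ : Fin d) (n : ℕ) :
    segUp A w κ (n + 1) = A κ w :: segUp A (w + unitVec κ) κ n := by
  induction n with
  | zero => simp [AveragingContours.segUp_succ]
  | succ n ih =>
    have hpt : w + ((n + 1 : ℕ) : ℤ) • unitVec κ = w + unitVec κ + (n : ℤ) • unitVec κ := by
      simp only [Nat.cast_succ, add_smul, one_smul]; abel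
    rw [AveragingContours.segUp_succ, ih, hpt, List.cons_append, ← AveragingContours.segUp_succ]

/-- [folklore] `rev` of a cons. -/
theorem rev_cons {R : Type*} [AddCommGroup R] (a : R) (l : List R) : rev (a :: l) = rev l ++ [-a] := by
  simp [rev]

/-- [folklore] A downward segment is the reversed upward segment based `n` steps lower. -/
theorem segDown_eq_rev_segUp {R : Type*} [AddCommGroup R] (A : Form1 d R) (z : Fin d → ℤ) (κ : Fin d) (n : ℕ) :
    segDown A z κ n = rev (segUp A (z - (n : ℤ) • unitVec κ) κ n) := by
  induction n with
  | zero => simp [rev]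
  | succ n ih =>
    have hpt : z - ((n + 1 : ℕ) : ℤ) • unitVec κ + unitVec κ = z - (n : ℤ) • unitVec κ := by
      simp only [Nat.cast_succ, add_smul, one_smul]; abel
    rw [AveragingContours.segDown_succ, segUp_succ', rev_cons, hpt, ← ih, Nat.cast_succ]

end Primitives

/-! ## §3 The rooted axial projector -/

section Rooted

variable {R : Type*} [AddCommGroup R]

/-- [folklore] **THE ROOTED AXIAL PROJECTOR** `Π^ρ A = A − grad λ^ρ_A`.  `ρ = 0` is `AxialProjector.axProj` (`axProjAt_zero`). -/
def axProjAt (ρ : Fin d → ℤ) (L : ℕ) (A : Form1 d R) : Form1 d R := A - grad (treeGaugeAt ρ A L)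

/-! ### §3.1 The base root `ρ = 0` is an2's projector -/

/-- [folklore] The base-rooted projector is an2's `axProj` (and `treeGaugeAt 0 = treeGauge`, an1's bridge, function-level). -/
@[simp] theorem axProjAt_zero (L : ℕ) (A : Form1 d R) : axProjAt 0 L A = axProj L A := by
  have h : treeGaugeAt 0 A L = treeGauge A L := funext (treeGaugeAt_zero A L)
  rw [axProjAt, axProj, h]

/-! ### §3.2 Root-parametric structure of the projector (in-block root offsets) -/

/-- [folklore] The rooted tree gauge at a block point, for an IN-BLOCK root offset `ρ = toSite r`. -/
theorem treeGaugeAt_block {L : ℕ} {r : Fin d → ℕ} (A : Form1 d R) (y : Fin d → ℤ) {b : Fin d → ℕ}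
    (hb : b ∈ box d L) :
    treeGaugeAt (toSite r) A L ((L : ℤ) • y + toSite b) = (axial A ((L : ℤ) • y + toSite r) ((L : ℤ) • y + toSite b)).sum := by
  rw [treeGaugeAt, blk_block y hb]

/-- [folklore] **THE ROOTED AXIAL GAUGE IS ATTAINABLE:** `Π^ρ A` satisfies the rooted (1.10), for every in-block root offset
`ρ = toSite r`, `r ∈ {0,…,L−1}^d` (an1's `axialGaugeAt_treeGaugeAt`, restated for `Π^ρ` by name). -/
theorem axialGaugeAt_axProjAt {L : ℕ} {r : Fin d → ℕ} (hr : r ∈ box d L) (A : Form1 d R) :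
    AxialGaugeAt (toSite r) (axProjAt (toSite r) L A) L :=
  axialGaugeAt_treeGaugeAt A L hr

/-- [folklore] Pointwise form of `Π^ρ`. -/
theorem axProjAt_apply (ρ : Fin d → ℤ) (L : ℕ) (A : Form1 d R) (κ : Fin d) (x : Fin d → ℤ) :
    axProjAt ρ L A κ x = A κ x - (treeGaugeAt ρ A L (x + unitVec κ) - treeGaugeAt ρ A L x) := rfl

/-- [folklore] The rooted tree gauge vanishes at the roots (in-block root offset). -/
theorem treeGaugeAt_root {L : ℕ} {r : Fin d → ℕ} (hr : r ∈ box d L) (A : Form1 d R) (y : Fin d → ℤ) :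
    treeGaugeAt (toSite r) A L ((L : ℤ) • y + toSite r) = 0 := by
  rw [treeGaugeAt_block A y hr, axial_self, List.sum_nil]

/-- [folklore] The rooted tree gauge of a field in the rooted axial gauge vanishes identically (`1 ≤ L`, in-block root). -/
theorem treeGaugeAt_eq_zero_of_axialGaugeAt {L : ℕ} (hL : 1 ≤ L) {r : Fin d → ℕ} {A : Form1 d R}
    (hA : AxialGaugeAt (toSite r) A L) : treeGaugeAt (toSite r) A L = 0 := by
  funext x
  have h := hA (blk L x) (AveragingContours.off L x) (AveragingContours.off_mem_box hL x)
  rw [AveragingContours.blk_add_off hL x] at h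
  exact h

/-- [folklore] **`Π^ρ` IS IDEMPOTENT** (`1 ≤ L`, in-block root offset). -/
theorem axProjAt_idem {L : ℕ} (hL : 1 ≤ L) {r : Fin d → ℕ} (hr : r ∈ box d L) (A : Form1 d R) :
    axProjAt (toSite r) L (axProjAt (toSite r) L A) = axProjAt (toSite r) L A := by
  rw [axProjAt, treeGaugeAt_eq_zero_of_axialGaugeAt hL (axialGaugeAt_axProjAt hr A)]
  funext κ x
  simp [grad]

/-- [folklore] `Π^ρ` FIXES the fields already in the rooted axial gauge (`1 ≤ L`, in-block root offset). -/
theorem axProjAt_eq_self_of_axialGaugeAt {L : ℕ} (hL : 1 ≤ L) {r : Fin d → ℕ} {A : Form1 d R}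
    (hA : AxialGaugeAt (toSite r) A L) : axProjAt (toSite r) L A = A := by
  rw [axProjAt, treeGaugeAt_eq_zero_of_axialGaugeAt hL hA]
  funext κ x
  simp [grad]

/-- [folklore] The centre offset is an in-block offset: every `toSite r` statement above applies to `ctr d L`
(`ctrOff_mem_box : 1 ≤ L → ctrOff d L ∈ box d L` in an1's leaf). -/
theorem ctr_eq_toSite (L : ℕ) : ctr d L = toSite (ctrOff d L) := rfl

end Rooted

/-! ## §4 Reflection covariance of the CENTRE-rooted objects (`L` odd) -/

section Centred

/-- [folklore] `R1` is compatible with subtraction. -/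
theorem R1_sub (α : Fin d) (A B : Form1 d ℝ) : R1 α (A - B) = R1 α A - R1 α B := by
  funext κ x
  simp only [R1_apply, Pi.sub_apply, mul_sub]

/-- [folklore] `grad` on scalars commutes with the reflection (an1's `grad` = an2's `dz`, `ResolventReflection.dz_R0`). -/
theorem grad_R0 (α : Fin d) (f : Form0 d ℝ) : grad (R0 α f) = R1 α (grad f) := by
  rw [grad_eq_dz, grad_eq_dz]
  exact dz_R0 α f

/-- [folklore] The straight part of (14) is reflection-covariant (it is an2's `contourSum`: `ResolventReflection.contourSum_R1`). -/
theorem straightSum_R1 (α : Fin d) (A : Form1 d ℝ) (L : ℕ) (μ : Fin d) (y : Fin d → ℤ) :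
    straightSum (R1 α A) L μ y = reflSign α μ * straightSum A L μ (bref α μ y) := by
  rw [straightSum_eq_contourSum, straightSum_eq_contourSum, contourSum_R1]
  rfl

/-- [folklore] **THE CENTRED BLOCK POTENTIAL IS A REFLECTION SCALAR:** `Λ^{ρ_c}_{R1 A}(y) = Λ^{ρ_c}_A(sref y)` (`L` odd) — the
comb is transported (`axial_R1`), the centre root goes to the centre root (`sref_root_ctr`), the block to the block
(`ResolventReflection.sref_block`), and the sum over the block is re-indexed by `bflip` (`ResolventReflection.sum_box_bflip`). -/
theorem LamAt_R1 {L : ℕ} (hL : Odd L) (α : Fin d) (A : Form1 d ℝ) (y : Fin d → ℤ) :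
    LamAt (ctr d L) (R1 α A) L y = LamAt (ctr d L) A L (sref α y) := by
  unfold LamAt
  have key : ∀ b ∈ box d L, (axial (R1 α A) ((L : ℤ) • y + ctr d L) ((L : ℤ) • y + toSite b)).sum
      = (axial A ((L : ℤ) • sref α y + ctr d L) ((L : ℤ) • sref α y + toSite (bflip α L b))).sum := by
    intro b hb
    have hr := sref_root_ctr (d := d) hL α y
    rw [axial_R1, hr, sref_block α hb]
  rw [Finset.sum_congr rfl key]
  exact sum_box_bflip α L (fun b => (axial A ((L : ℤ) • sref α y + ctr d L) ((L : ℤ) • sref α y + toSite b)).sum)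

/-- [folklore] **THE CENTRED LINEAR AVERAGING IS REFLECTION-COVARIANT** (`L` odd, EVERY axis `α`):
`linAvgAt ρ_c (R1 α A) L = R1 α (linAvgAt ρ_c A L)` — Bałaban's (14) with his own centred (1.7)-contours commutes with all
block-compatible axis reflections.  (FALSE at the base root `ρ = 0` already for `d = 2`, `L = 2`: NOTE X-an5-17 and its
kernel certificate.) -/
theorem linAvgAt_R1 {L : ℕ} (hL : Odd L) (α : Fin d) (A : Form1 d ℝ) :
    linAvgAt (ctr d L) (R1 α A) L = R1 α (linAvgAt (ctr d L) A L) := by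
  funext μ y
  rw [R1_apply, linAvgAt_eq_straight_sub_grad, linAvgAt_eq_straight_sub_grad, straightSum_R1, LamAt_R1 hL,
    LamAt_R1 hL]
  by_cases h : μ = α
  · subst h
    rw [reflSign_self, bref_self, sref_add, axisReflect_unitVec_self, sub_add_cancel, ← sub_eq_add_neg]
    ring
  · rw [reflSign_of_ne h, bref_of_ne h, sref_add, axisReflect_unitVec_of_ne h]
    ring

/-- [folklore] **THE CENTRED TREE GAUGE IS A REFLECTION SCALAR:** `λ^{ρ_c}_{R1 A} = R0 α (λ^{ρ_c}_A)` (`L` odd). -/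
theorem treeGaugeAt_R1 {L : ℕ} (hL : Odd L) (α : Fin d) (A : Form1 d ℝ) :
    treeGaugeAt (ctr d L) (R1 α A) L = R0 α (treeGaugeAt (ctr d L) A L) := by
  funext x
  have hr := sref_root_ctr (d := d) hL α (blk L x)
  rw [R0_apply, treeGaugeAt, treeGaugeAt, axial_R1, hr, blk_sref hL.pos]

/-- [folklore] **THE CENTRED AXIAL PROJECTOR IS REFLECTION-COVARIANT** (`L` odd, EVERY axis `α`):
`Π^{ρ_c} (R1 α A) = R1 α (Π^{ρ_c} A)`.  (FALSE at the base root: `axProj 2 (R1 α A0) ≠ R1 α (axProj 2 A0)`, NOTE X-an5-17.) -/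
theorem axProjAt_R1 {L : ℕ} (hL : Odd L) (α : Fin d) (A : Form1 d ℝ) :
    axProjAt (ctr d L) L (R1 α A) = R1 α (axProjAt (ctr d L) L A) := by
  rw [axProjAt, axProjAt, treeGaugeAt_R1 hL, grad_R0, R1_sub]

/-- [folklore] The centred rooted axial gauge condition is reflection-invariant (`L` odd). -/
theorem axialGaugeAt_R1 {L : ℕ} (hL : Odd L) (α : Fin d) {A : Form1 d ℝ} (hA : AxialGaugeAt (ctr d L) A L) :
    AxialGaugeAt (ctr d L) (R1 α A) L := by
  intro y b hb
  have hr := sref_root_ctr (d := d) hL α y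
  rw [axial_R1, hr, sref_block α hb]
  exact hA (sref α y) (bflip α L b) (bflip_mem α hb)

end Centred

/-! ## §5 Reflection transport of the centred contours AS LETTER LISTS (`L` odd) -/

section Lists

/-- [folklore] `rev` is an anti-homomorphism for `++`. -/
theorem rev_append {R : Type*} [AddCommGroup R] (l l' : List R) : rev (l ++ l') = rev l' ++ rev l := by
  simp [rev, List.map_append, List.reverse_append]

/-- [folklore] `rev` is an involution. -/
@[simp] theorem rev_rev {R : Type*} [AddCommGroup R] (l : List R) : rev (rev l) = l := by
  simp [rev, List.map_reverse, List.map_map]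

/-- [folklore] **TRANSPORT OF `Γ^{ρ_c}_{c,x}` ACROSS THE AXIS** (`μ ≠ α`): the letters of `R1 α A` along `Γ^{ρ_c}_{(μ,y),x}` ARE
the letters of `A` along `Γ^{ρ_c}_{(μ, sref y), sref x}` — same orientation, as LISTS. -/
theorem gammaCAt_R1_of_ne {L : ℕ} (hL : Odd L) {α μ : Fin d} (h : μ ≠ α) (A : Form1 d ℝ) (y : Fin d → ℤ)
    {b : Fin d → ℕ} (hb : b ∈ box d L) :
    gammaCAt (ctr d L) (R1 α A) L μ y b = gammaCAt (ctr d L) A L μ (sref α y) (bflip α L b) := by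
  have hr := sref_root_ctr (d := d) hL α y
  have hx := sref_block α hb y
  have he : axisReflect α ((L : ℤ) • unitVec μ) = (L : ℤ) • unitVec μ := by
    rw [axisReflect_zsmul, axisReflect_unitVec_of_ne h]
  have hr' : sref α ((L : ℤ) • y + ctr d L + (L : ℤ) • unitVec μ) = (L : ℤ) • sref α y + ctr d L + (L : ℤ) • unitVec μ := by
    rw [sref_add, hr, he]
  have hx' : sref α ((L : ℤ) • y + toSite b + (L : ℤ) • unitVec μ)
      = (L : ℤ) • sref α y + toSite (bflip α L b) + (L : ℤ) • unitVec μ := by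
    rw [sref_add, hx, he]
  simp only [gammaCAt, axial_R1, segUp_R1_of_ne h, hr, hx, hr', hx']

/-- [folklore] **TRANSPORT OF `Γ^{ρ_c}_{c,x}` ALONG THE AXIS** (`μ = α`): the letters of `R1 α A` along `Γ^{ρ_c}_{(α,y),x}` ARE
the letters of `A` along `Γ^{ρ_c}_{(α, y′), x′}` REVERSED (`rev`: order reversed, letters negated), where
`y′ = bref α α y = sref y − e_α` is the reflected coarse bond re-based and `x′ = sref x − L e_α ∈ B(y′)` — as LISTS. -/
theorem gammaCAt_R1_self {L : ℕ} (hL : Odd L) (α : Fin d) (A : Form1 d ℝ) (y : Fin d → ℤ) {b : Fin d → ℕ}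
    (hb : b ∈ box d L) :
    gammaCAt (ctr d L) (R1 α A) L α y b = rev (gammaCAt (ctr d L) A L α (bref α α y) (bflip α L b)) := by
  have hr := sref_root_ctr (d := d) hL α y
  have hx := sref_block α hb y
  have he : axisReflect α ((L : ℤ) • unitVec α) = -((L : ℤ) • unitVec α) := by
    rw [axisReflect_zsmul, axisReflect_unitVec_self, smul_neg]
  -- the four reflected endpoints, written over `y′ = sref y − e_α`
  have p1 : sref α ((L : ℤ) • y + ctr d L) = (L : ℤ) • (sref α y - unitVec α) + ctr d L + (L : ℤ) • unitVec α := by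
    rw [hr, smul_sub]; abel
  have p2 : sref α ((L : ℤ) • y + toSite b)
      = (L : ℤ) • (sref α y - unitVec α) + toSite (bflip α L b) + (L : ℤ) • unitVec α := by
    rw [hx, smul_sub]; abel
  have p3 : sref α ((L : ℤ) • y + ctr d L + (L : ℤ) • unitVec α) = (L : ℤ) • (sref α y - unitVec α) + ctr d L := by
    rw [sref_add, hr, he, smul_sub]; abel
  have p4 : sref α ((L : ℤ) • y + toSite b + (L : ℤ) • unitVec α)
      = (L : ℤ) • (sref α y - unitVec α) + toSite (bflip α L b) := by
    rw [sref_add, hx, he, smul_sub]; abel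
  have p5 : (L : ℤ) • (sref α y - unitVec α) + toSite (bflip α L b) + (L : ℤ) • unitVec α - (L : ℤ) • unitVec α
      = (L : ℤ) • (sref α y - unitVec α) + toSite (bflip α L b) := add_sub_cancel_right _ _
  rw [bref_self, gammaCAt, gammaCAt, axial_R1, axial_R1, segUp_R1_self, segDown_eq_rev_segUp, p1, p2, p3, p4, p5,
    rev_append, rev_append, rev_rev]
  simp only [List.append_assoc]

/-- [folklore] **TRANSPORT OF THE CENTRED LOOP ACROSS THE AXIS** (`μ ≠ α`): same loop at the reflected bond, same
orientation, as LISTS. -/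
theorem loopCAt_R1_of_ne {L : ℕ} (hL : Odd L) {α μ : Fin d} (h : μ ≠ α) (A : Form1 d ℝ) (y : Fin d → ℤ)
    {b : Fin d → ℕ} (hb : b ∈ box d L) :
    loopCAt (ctr d L) (R1 α A) L μ y b = loopCAt (ctr d L) A L μ (sref α y) (bflip α L b) := by
  have hr := sref_root_ctr (d := d) hL α y
  rw [loopCAt, loopCAt, gammaCAt_R1_of_ne hL h A y hb, segUp_R1_of_ne h, hr]

/-- [folklore] Rotating `l ++ l'` by `|l|` gives `l' ++ l`. -/
theorem rotate_append_of_length_eq {R : Type*} {l : List R} {n : ℕ} (h : l.length = n) (l' : List R) :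
    (l ++ l').rotate n = l' ++ l := by
  subst h; exact List.rotate_append_length_eq l l'

/-- [folklore] **TRANSPORT OF THE CENTRED LOOP ALONG THE AXIS** (`μ = α`): the REVERSED loop at the re-based reflected bond
`(α, bref α α y)`, read from the other root — i.e. `rev` of it, cyclically rotated by the `L` letters of the closing
segment — as LISTS. -/
theorem loopCAt_R1_self {L : ℕ} (hL : Odd L) (α : Fin d) (A : Form1 d ℝ) (y : Fin d → ℤ) {b : Fin d → ℕ}
    (hb : b ∈ box d L) :
    loopCAt (ctr d L) (R1 α A) L α y b = (rev (loopCAt (ctr d L) A L α (bref α α y) (bflip α L b))).rotate L := by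
  have hr := sref_root_ctr (d := d) hL α y
  have p1 : (L : ℤ) • sref α y + ctr d L - (L : ℤ) • unitVec α = (L : ℤ) • (sref α y - unitVec α) + ctr d L := by
    rw [smul_sub]; abel
  rw [loopCAt, loopCAt, gammaCAt_R1_self hL α A y hb, segUp_R1_self, segDown_eq_rev_segUp, hr, p1, bref_self, rev_append,
    rev_rev, rotate_append_of_length_eq (AveragingContours.segUp_length _ _ _ _)]

/-- [folklore] **AT THE LEVEL OF SUMS, ONE LAW FOR ALL AXES:** `(R1 α A)(loop^{ρ_c}_{(μ,y),x}) = ε_{αμ} · A(loop^{ρ_c}_{(μ, bref y), x̃})`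
with `x̃` the `bflip`-reflected offset (`L` odd). -/
theorem loopCAt_R1_sum {L : ℕ} (hL : Odd L) (α μ : Fin d) (A : Form1 d ℝ) (y : Fin d → ℤ) {b : Fin d → ℕ}
    (hb : b ∈ box d L) :
    (loopCAt (ctr d L) (R1 α A) L μ y b).sum = reflSign α μ * (loopCAt (ctr d L) A L μ (bref α μ y) (bflip α L b)).sum := by
  by_cases h : μ = α
  · subst h
    rw [loopCAt_R1_self hL μ A y hb, (List.rotate_perm _ _).sum_eq, rev_sum, reflSign_self, neg_one_mul]
  · rw [loopCAt_R1_of_ne hL h A y hb, reflSign_of_ne h, one_mul, bref_of_ne h]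

/-- [folklore] The same for the open contours `Γ^{ρ_c}`. -/
theorem gammaCAt_R1_sum {L : ℕ} (hL : Odd L) (α μ : Fin d) (A : Form1 d ℝ) (y : Fin d → ℤ) {b : Fin d → ℕ}
    (hb : b ∈ box d L) :
    (gammaCAt (ctr d L) (R1 α A) L μ y b).sum = reflSign α μ * (gammaCAt (ctr d L) A L μ (bref α μ y) (bflip α L b)).sum := by
  by_cases h : μ = α
  · subst h
    rw [gammaCAt_R1_self hL μ A y hb, rev_sum, reflSign_self, neg_one_mul]
  · rw [gammaCAt_R1_of_ne hL h A y hb, reflSign_of_ne h, one_mul, bref_of_ne h]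

end Lists

end Literature.MathematicalPhysics.QuantumFieldTheory.Balaban1983to89.Beta.RootedComb
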